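import Summits.BirchSwinnertonDyer.Rank1Residual.Additive.ShaGrowthDichotomyThree
import HarnessLib

/-!
# `ShaGrowthRateDichotomyThree` — ERRATUM to `ShaGrowthDichotomyThree` (T-O6-D′ v1 → v2) and the
companion Ш-law (o6-r1 GEN 5; cell b2b-bsdres, lane CLASS-CLOSURE, O6 = wild additive `p = 3`)

HONEST FRAMING: census output is EVIDENCE / conjecture items with held-out validation, never a
Literature fact; no main conjecture inside any certificate; nothing is booked; no mark moves. 0 named
Literature facts here; the two laws below are `@[conjecture]` EVIDENCE nodes; everything else is proved
arithmetic on explicit numbers.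

## ERRATUM (o6-r1 GEN 5, supersedes the `LocIrr` clause of `ShaGrowthDichotomyThree`)
`ShaGrowthDichotomyThree` (landed from o6-r1 GEN 4's sketch 07dc3ac4519b7db8) asserts on the residually
irreducible branch `M = shaSlopeIrrThree (v₃Δ) = v₃Δ/12 + 3/8` for the eventual slope `M` of the
Ш-increments `Δs_n = s_n − s_{n−1}`, `s_n = v₃ #Ш(W/ℚ_n)`. That constant was obtained from BSD₃(W/ℚ_n)
bookkeeping in which the PERIOD increment was booked as `v(u_n) − 3·v(u_{n−1})` (an `O(1)` quantity).
The correct increment is `v(u_n) − v(u_{n−1})`: the period of `W` over the layer `ℚ_n` (totally real,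
degree `3^n`, totally ramified at `3`) is `Ω(W/ℚ)^{3^n}·3^{v(u_n)}` with `12·v(u_n) = 3^n·v₃(Δ_min) −
v(Δ_min(W/ℚ_n))` (Dokchitser–Dokchitser; Lei–Pollack–Pratap, Lemma 3.11 and the proof of Thm 4.7), and
`v(u_n) − v(u_{n−1}) = (v₃Δ/12)·φ(3^n) + O(1)`. Hence the Ш-slope is the Mazur–Tate slope MINUS
`v₃Δ/12`:  `M_Ш = M_MT − v₃Δ/12`, i.e. on the irreducible branch `M_Ш = 3/8 = shaRateIrrThree`
(UNIVERSAL — independent of `v₃Δ`), and `shaSlopeIrrThree v = v/12 + shaRateIrrThree` is the MAZUR–TATE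
slope of T-O6-D (`MazurTateGrowthDichotomyThree`), not the Ш-slope (`shaSlopeIrrThree_eq_mtSlope` below).
On the reducible branch the correction preserves `12·M ∈ ℤ` (measured `M ∈ {1/12, 1/6, 1/4, 1/3, 3/4}`).
CONSEQUENCE: `ShaGrowthDichotomyThree`'s irreducible clause is WITHDRAWN by its author (expected to
contradict BSD₃ over the layers; EVIDENCE) — cite `ShaGrowthRateDichotomyThree` instead; its reducible
clause, `IsCompanionThree`, `CompanionTypeIffLocIrrThree` and `CompanionLambdaShiftThree` (a statement
about Mazur–Tate elements, untouched by the period term) stand as landed.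

## EVIDENCE for v2 (o6-r1 GEN 5 re-score, pre-registered templates; 184 potentially supersingular
classes `9 ∣ N ≤ 700`, layers `n ≤ 4`, number-field side kit j125845 + ENG-D Mazur–Tate side)
`LocIrr` rows: second difference `Δs₄ − Δs₂ = 18 = 48·(3/8)` on 40/43 raw and 43/43 modulo the named
`k = 2` analytic transient (459a1/b1/g1: `22 = 18 + (λ′₄ − λ′₂)`), across `v₃Δ ∈ {3, 6, 9}` alike; the
11 rank-0 unit `LocIrr` rows with `v₃Δ = 9` have `Δs_n = 0, 2, 6, 20 = q_1..q_4` (Kurihara's numbers)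
EXACTLY; `¬LocIrr` rows: `48·M` with `12M ∈ ℤ` on 139/139, law 135/136 (594c1 transient). Layer-1
anomalies (8 rows) are instrument effects settled by kit j128392 (naive-twist Euler defect on the
`(4,4)`-good rows; a `3`-divisible generator over `ℚ(ζ₉)⁺` on four rank-1 rows). Files:
`HOME/b2b-bsdres-o6-r1/gen5/` (`O6-GEN5.md`, `tower5/shagrowth_v2_*`).

## What a signed-Selmer theory at additive 3 must reproduce (the point of the node)
ITS CHARACTERISTIC POWER SERIES MUST GIVE THE SUPERSINGULAR RATE `3/8` — Kurihara's `q_n`-growth of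
good supersingular `a₃ = 0` curves — EXACTLY ON THE RESIDUALLY IRREDUCIBLE LOCUS, and an integral
`12M` on the reducible locus; `CompanionShaGrowthThree` says more sharply that Ш of the additive curve
grows up `ℚ_∞/ℚ` like Ш of its good supersingular companion, up to an eventually `2`-periodic shift.

## TYPER PLACEMENT NOTE (cc-typer-5 GEN 4, typer of record O5 §3.5 / O6 §3.4, 2026-08-21)
Landed from o6-r1 GEN 5's file `HOME/b2b-bsdres-o6-r1/gen5/ShaGrowthRateDichotomyThree.lean`
(sha16 bcb2fcfb66b44fe5) VERBATIM below this note (ASK A-O6-T5 (a), which supersedes A-O6-T4-v2: the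
standalone v2 sketch 7d328e8ffe767b5a is NOT landed because it re-declares v1's names). SUPERSEDE, NEVER
RE-WORD IN PLACE: the landed v1 node `ShaGrowthDichotomyThree` (p259222) keeps its statement and name;
its irreducible clause is WITHDRAWN by its author, and the withdrawal is recorded (i) here, by the node
`ShaGrowthRateDichotomyThree` under NEW names only, and (ii) by ERRATUM banners on the docstrings of
`ShaGrowthDichotomyThree`, `shaSlopeIrrThree` and `ShaGrowthDichotomyThree.secondDiff_irr` in a doc-only
re-land of `Additive/ShaGrowthDichotomyThree.lean` (A-O6-T5 (b); statements untouched). The typer's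
arithmetic check of the erratum is the kernel's: §4 below `decide`s, at `v₃Δ = 9` and `k = 2..5`, that the
tree's Mazur–Tate signed base `signedBase 9 k` minus the PERIOD increment `⌊3^k·9/12⌋ − ⌊3^{k−1}·9/12⌋`
is Kurihara's `q_k` (`signedBase_sub_periodIncr_values`), i.e. `M_Ш = M_MT − v₃Δ/12` on those layers, and
`shaSlopeIrrThree_eq_mtSlope` is `rfl`. Binders are those of v1 exactly (`Addv W 3`, `2 ≤ condExp W 3`,
potentially supersingular `0 < v₃(j) ∨ j = 0`, `ShaFinite` at every `CycLayerThree n`); selector `LocIrr W 3`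
(tree `Rank1Residual.LocIrr`). Audit marks expected: `conjecture` 2 (`ShaGrowthRateDichotomyThree`,
`CompanionShaGrowthThree`), `def` 1 (`shaRateIrrThree`), `orphan` on the proved arithmetic — the shape of a
typed-target file; 0 named Literature facts; nothing booked; no mark of `RESIDUAL-MAP.md` moves.
-/

set_option autoImplicit false

noncomputable section

open scoped Classical MatrixGroups ModularForm NumberField

open CongruenceSubgroup Polynomial WeierstrassCurve NumberField Literature.NumberTheory.EllipticCurves
  Literature.NumberTheory.EllipticCurves.ModularForms
  Literature.NumberTheory.EllipticCurves.Rank1Residual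
  Literature.NumberTheory.EllipticCurves.Rank1Residual.Typed
  Summit.BirchSwinnertonDyer.Rank1Residual.X1.MuLambda

namespace Summit.BirchSwinnertonDyer.Rank1Residual.Additive

/-! ## §1 The corrected constant -/

/-- The UNIVERSAL Ш-growth rate on the residually irreducible branch: `3/8` (so `Δs_n ≈ (3/8)·φ(3^n)`,
second differences `6·3^{n−1}`; Kurihara's `q_n = (3/8)·φ(3^n) − {1/4, 3/4}`). [folklore] -/
def shaRateIrrThree : ℚ := 3 / 8

/-- THE ERRATUM IN ONE LINE: v1's `shaSlopeIrrThree v = v/12 + 3/8` is the period rate `v/12` plus the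
Ш-rate `3/8` — it is the Mazur–Tate slope, not the Ш-slope. [folklore] -/
theorem shaSlopeIrrThree_eq_mtSlope (v : ℤ) : shaSlopeIrrThree v = (v : ℚ) / 12 + shaRateIrrThree := rfl

/-- `12 · (3/8) = 9/2 ∉ ℤ`: the two branches of the dichotomy stay distinguishable by `12M ∈ ℤ`. [folklore] -/
theorem twelve_mul_shaRateIrrThree_ne_int (z : ℤ) : 12 * shaRateIrrThree ≠ (z : ℚ) := by
  unfold shaRateIrrThree
  intro h
  have h2 : (2 * z : ℚ) = 9 := by linarith
  have h3 : (2 * z : ℤ) = 9 := by exact_mod_cast h2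
  omega

/-! ## §2 T-O6-D′ v2 — the corrected Ш-growth dichotomy (EVIDENCE conjecture) -/

/-- **T-O6-D′ v2 ≡ `ShaGrowthRateDichotomyThree` (CONJECTURE; EVIDENCE-labelled; o6-r1 GEN 5; SUPERSEDES
the irreducible clause of `ShaGrowthDichotomyThree`).** For `W/ℚ` additive at `3` with `f₃ ≥ 2` and
potentially SUPERSINGULAR reduction (`v₃(j) > 0` or `j = 0`), assuming `Ш(W/ℚ_n)` finite at every layer:
there are `M, e₀, e₁ ∈ ℚ` and `n₀` with `Δs_n(W) = M·φ(3^n) + e_{n mod 2}` for all `n ≥ n₀`, where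
`M = 3/8` if `W[3]|G_{ℚ₃}` is IRREDUCIBLE and `12·M ∈ ℤ` if it is REDUCIBLE. This is T-O6-D
(`MazurTateGrowthDichotomyThree`) read through BSD₃(W/ℚ_n) with the correct period increment
`v(u_n) − v(u_{n−1})` and the measured eventual `2`-periodicity of the remaining number-field terms,
stated WITHOUT Mazur–Tate elements. EVIDENCE and instrument caveats: module docstring. KILL: one
potentially supersingular class with `9 ∣ N` whose `Δs₄ − Δs₂ − (λ′₄ − λ′₂)` differs from `18` on a
`LocIrr` row, or whose `12·(Δs₄ − Δs₂)/48` is non-integral (mod the same transient) on a `¬LocIrr` row;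
eventually, any class with `Δs_{n+2} − Δs_n ≠ 16·M·3^{n−1}` at two consecutive `n ≥ 4`.
[cite: LeiPollackPratap2024, Thm 4.7 and Lemma 3.11] [cite: Kurihara2002, Thm. 0.1]
[cite: PollackWeston2011MT, Thm. 1] [cite: DoyonLei2021, §6] -/
@[conjecture] def ShaGrowthRateDichotomyThree : Prop :=
  ∀ (W : WeierstrassCurve ℚ) [W.IsElliptic] [W.IsGloballyMinimal],
    Addv W 3 → 2 ≤ condExp W 3 → (0 < padicValRat 3 W.j ∨ W.j = 0) →
    (∀ n : ℕ, (W.baseChange (CycLayerThree n)).ShaFinite) →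
    ∃ (M e₀ e₁ : ℚ) (n₀ : ℕ),
      (LocIrr W 3 → M = shaRateIrrThree) ∧
      (¬ LocIrr W 3 → ∃ z : ℤ, 12 * M = z) ∧
      ∀ n : ℕ, n₀ ≤ n →
        (shaIncrThree W n : ℚ) = M * (Nat.totient (3 ^ n) : ℚ) + (if n % 2 = 0 then e₀ else e₁)

/-- Under v2 the SECOND DIFFERENCE is geometric: `Δs_{n+3} − Δs_{n+1} = 16·M·3^n` for `n + 1 ≥ n₀`.
[folklore] -/
theorem ShaGrowthRateDichotomyThree.secondDiff (h : ShaGrowthRateDichotomyThree)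
    (W : WeierstrassCurve ℚ) [W.IsElliptic] [W.IsGloballyMinimal]
    (hadd : Addv W 3) (hf : 2 ≤ condExp W 3) (hss : 0 < padicValRat 3 W.j ∨ W.j = 0)
    (hfin : ∀ n : ℕ, (W.baseChange (CycLayerThree n)).ShaFinite) :
    ∃ (M : ℚ) (n₀ : ℕ), (LocIrr W 3 → M = shaRateIrrThree) ∧ (¬ LocIrr W 3 → ∃ z : ℤ, 12 * M = z) ∧
      ∀ n : ℕ, n₀ ≤ n + 1 →
        (shaIncrThree W (n + 3) : ℚ) - shaIncrThree W (n + 1) = 16 * M * 3 ^ n := by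
  obtain ⟨M, e₀, e₁, n₀, hirr, hred, hlaw⟩ := h W hadd hf hss hfin
  refine ⟨M, n₀, hirr, hred, fun n hn ↦ ?_⟩
  have h1 := hlaw (n + 1) hn
  have h3 := hlaw (n + 3) (by omega)
  have hpar : (n + 3) % 2 = (n + 1) % 2 := by omega
  rw [h1, h3, hpar, show n + 3 = (n + 2) + 1 from rfl, totient_three_pow_succ, totient_three_pow_succ]
  push_cast
  ring

/-- On the IRREDUCIBLE branch the second difference is UNIVERSAL: `Δs_{n+3} − Δs_{n+1} = 2·3^{n+1}`
(`= 18, 54, 162` at `n = 1, 2, 3`; `= q_{n+3} − q_{n+1}`), independent of `v₃Δ` — contrast v1's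
`(18 + 4·v₃Δ)·3^n / 3`. [folklore] -/
theorem ShaGrowthRateDichotomyThree.secondDiff_irr (h : ShaGrowthRateDichotomyThree)
    (W : WeierstrassCurve ℚ) [W.IsElliptic] [W.IsGloballyMinimal]
    (hadd : Addv W 3) (hf : 2 ≤ condExp W 3) (hss : 0 < padicValRat 3 W.j ∨ W.j = 0)
    (hfin : ∀ n : ℕ, (W.baseChange (CycLayerThree n)).ShaFinite) (hirr : LocIrr W 3) :
    ∃ n₀ : ℕ, ∀ n : ℕ, n₀ ≤ n + 1 →
      (shaIncrThree W (n + 3) : ℚ) - shaIncrThree W (n + 1) = 2 * 3 ^ (n + 1) := by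
  obtain ⟨M, n₀, hM, -, hlaw⟩ := h.secondDiff W hadd hf hss hfin
  refine ⟨n₀, fun n hn ↦ ?_⟩
  rw [hlaw n hn, hM hirr]
  unfold shaRateIrrThree
  ring

/-! ## §3 The companion Ш-law (EVIDENCE conjecture, new in GEN 5) -/

/-- **`CompanionShaGrowthThree` (CONJECTURE; EVIDENCE-labelled; o6-r1 GEN 5).** For `W` additive at `3`
(`f₃ ≥ 2`, potentially supersingular) and a companion `A` (`IsCompanionThree W A`: good at `3`,
`A[3] ≅ W[3]`) that is SUPERSINGULAR at `3` (`3 ∣ a₃(A)`; by `CompanionTypeIffLocIrrThree` this is the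
`LocIrr` branch) with the same Mordell–Weil rank, Ш finite at every layer for both: `Δs_n(W) − Δs_n(A)`
is EVENTUALLY `2`-PERIODIC — Ш of the additive curve grows up `ℚ_∞/ℚ` exactly like Ш of its good
supersingular companion (Kurihara `q_n`), up to a parity-dependent constant. EVIDENCE: the 11 rank-0 unit
`LocIrr` rows realise `Δs_n = q_n` on the nose (`n ≤ 4`); the general `LocIrr` rate `3/8` = the `q_n`
rate (`kuriharaQ_rate_values`). First computation: cc-eng-3 ASK A-ENG3-4 (companion `θ_k` tables) +
`dl_nf.gp` on the companions. KILL: a (W, A) pair as above with `(Δs₄ − Δs₂)(W) ≠ (Δs₄ − Δs₂)(A)`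
modulo the named `k = 2` transients. [cite: Kurihara2002, Thm. 0.1] [cite: PollackWeston2011MT, Thm. 1]
-/
@[conjecture] def CompanionShaGrowthThree : Prop :=
  ∀ (W A : WeierstrassCurve ℚ) [W.IsElliptic] [W.IsGloballyMinimal] [A.IsElliptic]
    [A.IsGloballyMinimal], Addv W 3 → 2 ≤ condExp W 3 → (0 < padicValRat 3 W.j ∨ W.j = 0) →
    IsCompanionThree W A → (3 : ℤ) ∣ A.frobeniusTrace 3 → W.mordellWeilRank = A.mordellWeilRank →
    (∀ n : ℕ, (W.baseChange (CycLayerThree n)).ShaFinite) →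
    (∀ n : ℕ, (A.baseChange (CycLayerThree n)).ShaFinite) →
    ∃ (d₀ d₁ : ℤ) (n₀ : ℕ), ∀ n : ℕ, n₀ ≤ n →
      shaIncrThree W n - shaIncrThree A n = if n % 2 = 0 then d₀ else d₁

/-! ## §4 Kernel sanity (values PROVED; nothing conjectural) -/

/-- Kurihara's `q_n` realises the irreducible template: `q_{n+2} − q_n = 2·3^n` at `n = 1, …, 4`
(`6, 18, 54, 162`). [folklore] -/
theorem kuriharaQ_secondDiff_values :
    O5.kuriharaQ 3 - O5.kuriharaQ 1 = 6 ∧ O5.kuriharaQ 4 - O5.kuriharaQ 2 = 18 ∧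
      O5.kuriharaQ 5 - O5.kuriharaQ 3 = 54 ∧ O5.kuriharaQ 6 - O5.kuriharaQ 4 = 162 := by
  decide

/-- `q_n = (3/8)·φ(3^n) − {3/4, 1/4 by parity}`: `8·q_n + {6, 2} = 6·3^{n−1}` at `n = 1..6`. [folklore] -/
theorem kuriharaQ_rate_values :
    8 * O5.kuriharaQ 1 + 6 = 6 * 3 ^ 0 ∧ 8 * O5.kuriharaQ 2 + 2 = 6 * 3 ^ 1 ∧
      8 * O5.kuriharaQ 3 + 6 = 6 * 3 ^ 2 ∧ 8 * O5.kuriharaQ 4 + 2 = 6 * 3 ^ 3 ∧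
      8 * O5.kuriharaQ 5 + 6 = 6 * 3 ^ 4 ∧ 8 * O5.kuriharaQ 6 + 2 = 6 * 3 ^ 5 := by
  decide

/-- The Mazur–Tate signed base minus the PERIOD INCREMENT is Kurihara's `q`: at `v₃Δ = 9`,
`signedBase 9 k − (⌊3^k·9/12⌋ − ⌊3^{k−1}·9/12⌋) = q_k` for `k = 2..5`
(`(6,20,60,182) − (4,14,40,122) = (2,6,20,60)`) — the ERRATUM in numbers. [folklore] -/
theorem signedBase_sub_periodIncr_values :
    signedBase 9 2 - ((3 ^ 2 * 9) / 12 - (3 ^ 1 * 9) / 12) = O5.kuriharaQ 2 ∧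
      signedBase 9 3 - ((3 ^ 3 * 9) / 12 - (3 ^ 2 * 9) / 12) = O5.kuriharaQ 3 ∧
      signedBase 9 4 - ((3 ^ 4 * 9) / 12 - (3 ^ 3 * 9) / 12) = O5.kuriharaQ 4 ∧
      signedBase 9 5 - ((3 ^ 5 * 9) / 12 - (3 ^ 4 * 9) / 12) = O5.kuriharaQ 5 := by
  decide

/-- Same at `v₃Δ = 3` up to the `∓1` parity term: `signedBase 3 k − (⌊3^k/4⌋ − ⌊3^{k−1}/4⌋) = q_k ∓ 1`
for `k = 2..5`. [folklore] -/
theorem signedBase_three_sub_periodIncr_values :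
    signedBase 3 2 + 1 - ((3 ^ 2 * 3) / 12 - (3 ^ 1 * 3) / 12) = O5.kuriharaQ 2 ∧
      signedBase 3 3 - ((3 ^ 3 * 3) / 12 - (3 ^ 2 * 3) / 12) = O5.kuriharaQ 3 + 1 ∧
      signedBase 3 4 + 1 - ((3 ^ 4 * 3) / 12 - (3 ^ 3 * 3) / 12) = O5.kuriharaQ 4 ∧
      signedBase 3 5 - ((3 ^ 5 * 3) / 12 - (3 ^ 4 * 3) / 12) = O5.kuriharaQ 5 + 1 := by
  decide

end Summit.BirchSwinnertonDyer.Rank1Residual.Additive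

end
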